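import Literature.MathematicalPhysics.QuantumFieldTheory.Balaban1983to89.T4TrajectoryDensity

/-!
# `T4Continuum.T4TrajectoryDensityDressed` — THE (w2)-SPLIT: the dressed lattice pipeline of `T4TrajectoryDensity` (v1.2.1) fed by
# ACTION-exponent data of the printed type PLUS an oscillation-small OBSERVABLE-ATTACHED perturbation of the exponent (part 1 of 2;
# part 2 `T4TrajectoryDensityDressedLoop` transports the carried terms) (cell `pub-balaban`, sub-cell `t4`, spine estimate
# NE1′ (node O3b/H2), fan-out lineage t4-ne1p-p1 = PROVER seat P1, technique «RG-trajectory comparison: extend B12's (2.18)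
# inductive representation term by term with the observable insertion, tracking μ-uniformity through the printed small-field
# bounds», generation 21; tree target `Summits/QuantumFields/BalabanUV/T4Continuum/Support/`; ADDITIVE — imports the Literature
# leaf `T4TrajectoryDensity` ONLY and modifies nothing)

HONEST FRAMING.  Finite four-torus, rung (B)+1 only (the `ε → 0` limit of unit-scale averaged loop expectations on ONE torus of
fixed size) — NOT infinite volume, NOT a mass gap, NOT the Clay problem, NOT summit progress.  Cell dependency line, unchanged:
«continuum YM on T⁴ ⇐ BetaPertH ∧ nine spine estimates (0/9 proved); BetaPertH ⇐ (D1) ∧ (D4) ∧ CAP+tail; G-an2-4 gates asym, D1 and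
NE2/3/4».  ABSOLUTE RULE honoured: no internally-minted statement enters as a cited fact; every declaration below is [folklore]
kernel mathematics (dominated holomorphic parameter integrals, the triangle inequality, disc-in-tube geometry), 0 sorry, 0 citations
(nothing printed is transcribed; the printed kernels (1.73)–(1.75) of [Balaban1989LargeFieldII] p. 380 are carried VERBATIM by the
imported leaf's `norm_ratio_le` &c. and are used here BY NAME only).  THIS MODULE SAYS NOTHING ABOUT BAŁABAN'S DENSITIES: whether
they meet the hypothesis shapes is NOT PRINTED and is the cell wall (w1)–(w7) of record `t4/T4-EST-NE1p-P1.md`.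

WHY THIS LEAF (record `t4/T4-EST-NE1p-P1.md`, generation 21; wall clause (w2)).  The v1.2.1 capstone
`T4TrajectoryDensity.transportsFromVar_of_exponentSlicesAt_lattice` asks, per met step `k`, for a real regular base and an exponent
slice (`RealBaseAt` / `ExponentSliceAt`, oscillation `s k ≤ 1`) of the FULL exponent `𝒜 k` of the step weight `base·e^{−𝒜}` — and in
the observable-attached format that exponent is the action part PLUS the `μ`-proportional observable-attached terms generated and
carried by the earlier steps (the cell's reading of NE1′: "(2.18)-type representation extended by observable-attached terms,
μ-uniform constants").  Print types only the ACTION part ((1.65), (1.71)–(1.75) pp. 378–380: *"σ(X) is a sum of terms of 𝐁⁽ʲ⁾,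
j ≤ k, localized in X"*, *"|σ| ≤ 1"*); the observable-attached part is the pipeline's OWN carried data.  (w2) therefore SPLITS:
(w2-act) = `RealBaseAt`/`ExponentSliceAt` for the action exponent `𝒜⁰ k` (printed TYPE, not asserted), and (w2-obs) = the
observable-attached part `𝒬 k` is slice-holomorphic and OSCILLATION-small (about a free constant: constants in the exponent cancel
in the normalised operation) along the same lattice slices — a shape (`PertSlice`) with NO reality clause and NO reference
configuration (complex `μ` allowed), which part 2 §5 MANUFACTURES from what the pipeline already carries (a term's `BirthSlice` on
the coarser window + the nesting (N1) + a.e.-membership of the fluctuation variable) and part 2 §6 TRANSPORTS through one step by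
the printed small-field bound (1.75) (`norm_ratio_le`): analyticity radius `r ↦ ϱ` (any `ϱ < r`), size `A ↦ e^{3s}·A`.  The dressed
capstone (§4) is the v1.2.1 pipeline BY NAME (`T4TrajectoryModulus.transportsFromVar_of_linearOpSlicesOn_lattice`) with step
weight `base·e^{−(𝒜⁰ k + 𝒬 k)}` and oscillation budget `s⁰ k + s₁ k ≤ 1`: the `μ`-part of the exponent goes ENTIRELY into the
oscillation `σ` and a projective constant, the reference density stays the UNDRESSED real one `base·e^{−Re 𝒜⁰(ref U₀)}` — so no
reality is ever asked of an observable-attached term.  What (w2) still owes after parts 1–2 is exactly (w2-act) + the K-UNIFORM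
summability of the oscillation budgets along the trajectory (part 2 §8 types it as OBS-SUM and proves that WITHOUT an
oscillation-decay input the admissible source strength shrinks with the number of met steps); (w1), (w3)–(w7) are untouched.

DICTIONARY (cell reading, labelled, never asserted). `𝒜⁰ k` ↔ the action exponent of the k-th renormalization transformation in the
background field ((1.71) p. 379: *"𝐓′_k(X,(𝐔,𝐉))F = 𝐓′_k(X,(U,0)) e^{σ(X)} F"*); `𝒬 k` ↔ the observable-attached (source-proportional)
addition to that exponent in the dressed format; `ref k` ↔ `(𝐔,𝐉) ↦ (U,0)`.  INFO (generation 21, gloss only, kernel content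
unaffected): in [Balaban1987RGI] (1.8)–(1.10) pp. 261–262 the variable `𝐉` is the auxiliary 𝔤ᶜ-valued configuration replacing the
second-order derivative terms, with gauge action `(U,J)^u = (U^u, R(u)J)` — not an observable source; the observable enters the
cell's format through the carried terms, which is what `𝒬` models here.

CONTENTS (part 1 of 2; part 2 `T4TrajectoryDensityDressedLoop` = the carried terms).  §1 `PertSlice` — OSCILLATION currency
(about a free constant `q₀`: constants in the exponent cancel in the normalised operation) + closure under constants (size 0), sup
form, `+`, scalar multiples, finite sums, monotonicity.  §2 the PROJECTIVE weight slice `WeightSliceProj` (the leaf's `WeightSlice`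
up to a nonzero constant per slice), the projective invariance `wOp_const_mul`, and the supplier `opSliceOn_wOp_proj` (reduction
to the leaf's `opSliceOn_wOp` along one direction on a one-point window).  §3 the dressed supplier `weightSliceProj_of_dressed`
(`RealBaseAt` + `ExponentSliceAt` for `𝒜⁰`, `PertSlice` for `𝒬` ⟹ `WeightSliceProj` for `base·e^{−(𝒜⁰+𝒬)}` with oscillation
`s + s₁`) and the step law `opSliceOn_wOp_dressed`.  §4 the dressed lattice capstone `transportsFromVar_of_dressedExponent_lattice`
(conclusion `T.TransportsFromVar (4c_δ/r) (fun i => ψ·α i) Gate`, VERBATIM).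
-/

namespace Summit.QuantumFields.BalabanUV.T4Continuum.T4TrajectoryDensityDressed

open MeasureTheory Set Metric Filter
open Literature.MathematicalPhysics.QuantumFieldTheory.Balaban1983to89
open T4TermFormat T4TermFormat.Booking T4GatedBooking T4TrajectoryComparison T4TrajectoryModulus
open T4BirthChartTransport (GaugeInvariant BirthSlice RelGauge)
open T4BlockTransport (Fld NDir latMove latN)
open T4TrajectoryDensity

noncomputable section

/-! ## §1 The perturbation slice: an OSCILLATION-small, slice-holomorphic, a.e.-measurable addition to the exponent [folklore] -/

section PertSlice

variable {Z : Type*} [MeasurableSpace Z] {𝒰 Dir : Type*}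

/-- HYPOTHESIS SHAPE — **THE PERTURBATION SLICE** (the observable-attached part of a dressed exponent; cell reading, never
asserted): on the window `𝒦`, along every admissible slice `t ↦ move U₀ d t` (`0 < N d ≤ w`), the family `z ↦ 𝒬 (move U₀ d t) z`
is a.e.-strongly measurable for `t` in an open `Ω ⊇` the closed discs of radius `ϱ / N d` about `[0,1]`, HOLOMORPHIC in `t` on `Ω`
for a.e. `z`, and of OSCILLATION at most `s₁` there about SOME CONSTANT `q₀` (constants in the exponent cancel in the normalised
operation, `wOp_const_mul`; only the oscillation is paid for).  No reality clause, no reference configuration. [folklore] -/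
def PertSlice (𝒬 : 𝒰 → Z → ℂ) (μ : Measure Z) (move : 𝒰 → Dir → ℂ → 𝒰) (N : Dir → ℝ) (𝒦 : Set 𝒰)
    (w ϱ s₁ : ℝ) : Prop :=
  ∀ U₀ ∈ 𝒦, ∀ d : Dir, 0 < N d → N d ≤ w →
    ∃ Ω : Set ℂ, IsOpen Ω ∧ (∀ x ∈ Icc (0 : ℝ) 1, closedBall (x : ℂ) (ϱ / N d) ⊆ Ω) ∧
      (∀ t ∈ Ω, AEStronglyMeasurable (𝒬 (move U₀ d t)) μ) ∧
      (∀ᵐ z ∂μ, DifferentiableOn ℂ (fun t => 𝒬 (move U₀ d t) z) Ω) ∧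
      ∃ q₀ : ℂ, ∀ᵐ z ∂μ, ∀ t ∈ Ω, ‖𝒬 (move U₀ d t) z - q₀‖ ≤ s₁

variable {𝒬 𝒬₁ 𝒬₂ : 𝒰 → Z → ℂ} {μ : Measure Z} {move : 𝒰 → Dir → ℂ → 𝒰} {N : Dir → ℝ} {𝒦 𝒦' : Set 𝒰}
  {w ϱ ϱ' s₁ s₂ : ℝ}

/-- A CONSTANT perturbation is a perturbation slice of size `0`: constants are free (in particular the shape is inhabited). [folklore] -/
theorem pertSlice_const (c : ℂ) : PertSlice (fun (_ : 𝒰) (_ : Z) => c) μ move N 𝒦 w ϱ 0 :=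
  fun _ _ _ _ _ => ⟨univ, isOpen_univ, fun _ _ => subset_univ _, fun _ _ => aestronglyMeasurable_const,
    Eventually.of_forall fun _ => differentiableOn_const c, c, Eventually.of_forall fun _ _ _ => by simp⟩

/-- A sup-small family is oscillation-small about `q₀ = 0`: the sup form of the shape implies the oscillation form. [folklore] -/
theorem pertSlice_of_sup
    (h : ∀ U₀ ∈ 𝒦, ∀ d : Dir, 0 < N d → N d ≤ w →
      ∃ Ω : Set ℂ, IsOpen Ω ∧ (∀ x ∈ Icc (0 : ℝ) 1, closedBall (x : ℂ) (ϱ / N d) ⊆ Ω) ∧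
        (∀ t ∈ Ω, AEStronglyMeasurable (𝒬 (move U₀ d t)) μ) ∧
        (∀ᵐ z ∂μ, DifferentiableOn ℂ (fun t => 𝒬 (move U₀ d t) z) Ω) ∧
        (∀ᵐ z ∂μ, ∀ t ∈ Ω, ‖𝒬 (move U₀ d t) z‖ ≤ s₁)) :
    PertSlice 𝒬 μ move N 𝒦 w ϱ s₁ := by
  intro U₀ hU₀ d hd hdw
  obtain ⟨Ω, hΩ, hb, hm, hdf, hs⟩ := h U₀ hU₀ d hd hdw
  exact ⟨Ω, hΩ, hb, hm, hdf, 0, hs.mono fun z hz t ht => by simpa using hz t ht⟩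

/-- Perturbation slices add, sizes add (common domain = the intersection, constants add). [folklore] -/
theorem PertSlice.add (h₁ : PertSlice 𝒬₁ μ move N 𝒦 w ϱ s₁) (h₂ : PertSlice 𝒬₂ μ move N 𝒦 w ϱ s₂) :
    PertSlice (𝒬₁ + 𝒬₂) μ move N 𝒦 w ϱ (s₁ + s₂) := by
  intro U₀ hU₀ d hd hdw
  obtain ⟨Ω₁, hΩ₁, hb₁, hm₁, hd₁, q₁, hs₁⟩ := h₁ U₀ hU₀ d hd hdw
  obtain ⟨Ω₂, hΩ₂, hb₂, hm₂, hd₂, q₂, hs₂⟩ := h₂ U₀ hU₀ d hd hdw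
  refine ⟨Ω₁ ∩ Ω₂, hΩ₁.inter hΩ₂, fun x hx => subset_inter (hb₁ x hx) (hb₂ x hx),
    fun t ht => (hm₁ t ht.1).add (hm₂ t ht.2), ?_, q₁ + q₂, ?_⟩
  · filter_upwards [hd₁, hd₂] with z hz₁ hz₂
    exact (hz₁.mono inter_subset_left).add (hz₂.mono inter_subset_right)
  · filter_upwards [hs₁, hs₂] with z hz₁ hz₂ t ht
    have e : (𝒬₁ + 𝒬₂) (move U₀ d t) z - (q₁ + q₂) = (𝒬₁ (move U₀ d t) z - q₁) + (𝒬₂ (move U₀ d t) z - q₂) := by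
      simp only [Pi.add_apply]; ring
    rw [e]
    exact (norm_add_le _ _).trans (add_le_add (hz₁ t ht.1) (hz₂ t ht.2))

/-- Scalar multiples (e.g. by the source strength `μ`): size scales by the norm. [folklore] -/
theorem PertSlice.const_mul (h : PertSlice 𝒬 μ move N 𝒦 w ϱ s₁) (c : ℂ) :
    PertSlice (fun U z => c * 𝒬 U z) μ move N 𝒦 w ϱ (‖c‖ * s₁) := by
  intro U₀ hU₀ d hd hdw
  obtain ⟨Ω, hΩ, hb, hm, hdf, q₀, hs⟩ := h U₀ hU₀ d hd hdw
  refine ⟨Ω, hΩ, hb, fun t ht => (hm t ht).const_mul c, ?_, c * q₀, ?_⟩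
  · filter_upwards [hdf] with z hz
    exact hz.const_mul c
  · filter_upwards [hs] with z hz t ht
    rw [← mul_sub, norm_mul]
    exact mul_le_mul_of_nonneg_left (hz t ht) (norm_nonneg _)

/-- Monotonicity: larger size, smaller radius, smaller window. [folklore] -/
theorem PertSlice.mono (h : PertSlice 𝒬 μ move N 𝒦 w ϱ s₁) (hs : s₁ ≤ s₂) (hϱ : ϱ' ≤ ϱ) (h𝒦 : 𝒦' ⊆ 𝒦) :
    PertSlice 𝒬 μ move N 𝒦' w ϱ' s₂ := by
  intro U₀ hU₀ d hd hdw
  obtain ⟨Ω, hΩ, hb, hm, hdf, q₀, hs'⟩ := h U₀ (h𝒦 hU₀) d hd hdw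
  refine ⟨Ω, hΩ, fun x hx => (closedBall_subset_closedBall (div_le_div_of_nonneg_right hϱ hd.le)).trans (hb x hx),
    hm, hdf, q₀, ?_⟩
  filter_upwards [hs'] with z hz t ht
  exact (hz t ht).trans hs

/-- Finite sums of perturbation slices (the live observable-attached terms at one met step). [folklore] -/
theorem PertSlice.sum {ι : Type*} (S : Finset ι) {𝒬 : ι → 𝒰 → Z → ℂ} {s : ι → ℝ}
    (h : ∀ i ∈ S, PertSlice (𝒬 i) μ move N 𝒦 w ϱ (s i)) :
    PertSlice (fun U z => ∑ i ∈ S, 𝒬 i U z) μ move N 𝒦 w ϱ (∑ i ∈ S, s i) := by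
  classical
  induction S using Finset.induction_on with
  | empty => simpa using (pertSlice_const (Z := Z) (𝒰 := 𝒰) (μ := μ) (move := move) (N := N) (𝒦 := 𝒦) (w := w) (ϱ := ϱ) 0)
  | insert a S ha ih =>
    have e : (fun U z => ∑ i ∈ insert a S, 𝒬 i U z) = 𝒬 a + fun U z => ∑ i ∈ S, 𝒬 i U z := by
      funext U z
      simp [Finset.sum_insert ha]
    rw [e, Finset.sum_insert ha]
    exact (h a (Finset.mem_insert_self a S)).add (ih fun i hi => h i (Finset.mem_insert_of_mem hi))

end PertSlice

/-! ## §2 The PROJECTIVE weight slice (a weight slice up to a nonzero constant per slice) and its supplier [folklore] -/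

section Projective

variable {Z : Type*} [MeasurableSpace Z] {𝒰 Dir : Type*} {F : Type*} [NormedAddCommGroup F] [NormedSpace ℂ F]

/-- HYPOTHESIS SHAPE — **THE PROJECTIVE WEIGHT SLICE**: the leaf's `WeightSlice` VERBATIM except that the factorisation holds up
to a NONZERO CONSTANT per slice, `ω_{move U₀ d t} = c · ρ₀ e^{σ_t}` a.e. (`c ≠ 0` independent of `t` and `z`) — the normalised
operation does not see `c`. [folklore] -/
def WeightSliceProj (ω : 𝒰 → Z → ℂ) (μ : Measure Z) (move : 𝒰 → Dir → ℂ → 𝒰) (N : Dir → ℝ) (𝒦 : Set 𝒰)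
    (w ϱ s : ℝ) : Prop :=
  ∀ U₀ ∈ 𝒦, ∀ d : Dir, 0 < N d → N d ≤ w →
    ∃ Ω : Set ℂ, IsOpen Ω ∧ (∀ x ∈ Icc (0 : ℝ) 1, closedBall (x : ℂ) (ϱ / N d) ⊆ Ω) ∧
      ∃ ρ₀ : Z → ℝ, 0 ≤ᵐ[μ] ρ₀ ∧ Integrable ρ₀ μ ∧ 0 < ∫ z, ρ₀ z ∂μ ∧
        ∃ σ : ℂ → Z → ℂ, (∀ t ∈ Ω, AEStronglyMeasurable (σ t) μ) ∧
          (∀ᵐ z ∂μ, DifferentiableOn ℂ (fun t => σ t z) Ω) ∧ (∀ᵐ z ∂μ, ∀ t ∈ Ω, ‖σ t z‖ ≤ s) ∧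
          ∃ c : ℂ, c ≠ 0 ∧ ∀ t ∈ Ω, ω (move U₀ d t) =ᵐ[μ] fun z => c * weight ρ₀ (σ t) z

variable {ω : 𝒰 → Z → ℂ} {μ : Measure Z} {move : 𝒰 → Dir → ℂ → 𝒰} {N : Dir → ℝ} {𝒦 : Set 𝒰} {w ϱ s : ℝ}

omit [NormedAddCommGroup F] [NormedSpace ℂ F] in
/-- A weight slice is a projective weight slice (`c = 1`). [folklore] -/
theorem weightSliceProj_of_weightSlice (h : WeightSlice ω μ move N 𝒦 w ϱ s) : WeightSliceProj ω μ move N 𝒦 w ϱ s := by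
  intro U₀ hU₀ d hd hdw
  obtain ⟨Ω, hΩ, hballs, ρ₀, hρ0, hρ, hP, σ, hσm, hσd, hσb, hfac⟩ := h U₀ hU₀ d hd hdw
  exact ⟨Ω, hΩ, hballs, ρ₀, hρ0, hρ, hP, σ, hσm, hσd, hσb, 1, one_ne_zero,
    fun t ht => (hfac t ht).mono fun z hz => by simp [hz]⟩

/-- **PROJECTIVE INVARIANCE of the normalised operation**: rescaling the weight by a nonzero constant changes nothing (good set
and ratio alike). [folklore] -/
theorem wOp_const_mul {c : ℂ} (hc : c ≠ 0) (ω : 𝒰 → Z → ℂ) (μ : Measure Z) (z₀ : Z) (U : 𝒰) (h : Z → F) :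
    wOp (fun U z => c * ω U z) μ z₀ U h = wOp ω μ z₀ U h := by
  have hI : ∫ z, c * ω U z ∂μ = c * ∫ z, ω U z ∂μ := by
    simpa only [smul_eq_mul] using integral_smul c (ω U)
  have hiff : (Integrable (fun z => c * ω U z) μ ∧ (∫ z, c * ω U z ∂μ) ≠ 0) ↔
      (Integrable (ω U) μ ∧ (∫ z, ω U z ∂μ) ≠ 0) := by
    rw [hI, mul_ne_zero_iff]
    constructor
    · rintro ⟨hi, -, hne⟩
      refine ⟨?_, hne⟩
      have hi' := hi.const_mul c⁻¹
      simp only [inv_mul_cancel_left₀ hc] at hi'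
      exact hi'
    · rintro ⟨hi, hne⟩
      exact ⟨hi.const_mul c, hc, hne⟩
  by_cases hg : Integrable (ω U) μ ∧ (∫ z, ω U z ∂μ) ≠ 0
  · obtain ⟨hi, hne⟩ := hiff.mpr hg
    have hJ : ∫ z, (c * ω U z) • h z ∂μ = c • ∫ z, ω U z • h z ∂μ := by
      rw [← integral_smul]
      exact integral_congr_ae (Eventually.of_forall fun z => by simp [mul_smul])
    rw [wOp_of_pos hi hne, wOp_of_pos hg.1 hg.2, hI, hJ, smul_smul]
    congr 1
    field_simp
  · rw [wOp_of_neg (fun hg' => hg (hiff.mp hg')), wOp_of_neg hg]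

/-- **THE SUPPLIER FROM A PROJECTIVE WEIGHT SLICE** — the leaf's `opSliceOn_wOp` VERBATIM for projective weight slices: reduce to
it along the single direction `d` on the one-point window `{U₀}` for the rescaled weight `c⁻¹·ω`, then undo the rescaling by
`wOp_const_mul`. [folklore] -/
theorem opSliceOn_wOp_proj [CompleteSpace F] {D : Set Z} (z₀ : Z) (hws : WeightSliceProj ω μ move N 𝒦 w ϱ s) (hs : s ≤ 1)
    (hD : ∀ᵐ z ∂μ, z ∈ D) : OpSliceOn (BddClass F μ) (wOp ω μ z₀) D move N 𝒦 w ϱ (Real.exp (3 * s)) := by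
  intro h hh m hm U₀ hU₀ d hd hdw
  obtain ⟨Ω, hΩ, hballs, ρ₀, hρ0, hρ, hP, σ, hσm, hσd, hσb, c, hc, hfac⟩ := hws U₀ hU₀ d hd hdw
  have hws' : WeightSlice (fun U z => c⁻¹ * ω U z) μ (fun U (_ : Unit) t => move U d t) (fun _ => N d) {U₀} w ϱ s := by
    intro U hU e he hew
    obtain rfl := Set.mem_singleton_iff.mp hU
    refine ⟨Ω, hΩ, hballs, ρ₀, hρ0, hρ, hP, σ, hσm, hσd, hσb, fun t ht => ?_⟩
    filter_upwards [hfac t ht] with z hz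
    show c⁻¹ * ω (move U d t) z = weight ρ₀ (σ t) z
    rw [hz, inv_mul_cancel_left₀ hc]
  have key := opSliceOn_wOp z₀ hws' hs hD h hh m hm U₀ (Set.mem_singleton U₀) () hd hdw
  simpa only [wOp_const_mul (inv_ne_zero hc)] using key

end Projective

/-! ## §3 The dressed supplier: action-exponent data about a reference + a perturbation slice ⟹ a projective weight slice [folklore] -/

section Dressed

variable {Z : Type*} [MeasurableSpace Z] {𝒰 Dir : Type*}
variable {ref : 𝒰 → 𝒰} {base : Z → ℝ} {𝒜 𝒬 : 𝒰 → Z → ℂ} {μ : Measure Z} {move : 𝒰 → Dir → ℂ → 𝒰}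
  {N : Dir → ℝ} {𝒦 : Set 𝒰} {w ϱ s s₁ : ℝ}

omit [MeasurableSpace Z] in
/-- The factorisation behind the dressed (1.71): where the ACTION exponent at the reference `U₁` is real, for any constant `q₀`,
`base·e^{−(𝒜+𝒬)_U} = e^{−q₀} · (base·e^{−Re 𝒜_{U₁}}) · e^{𝒜_{U₁} − 𝒜_U − (𝒬_U − q₀)}` — the perturbation's OSCILLATION sits in the
exponent `σ`, its constant part in the projective factor. [folklore] -/
theorem expWeight_add_eq_mul_weight {U₁ U : 𝒰} {z : Z} (hre : (𝒜 U₁ z).im = 0) (q₀ : ℂ) :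
    expWeight base (𝒜 + 𝒬) U z =
      Complex.exp (-q₀) * weight (baseDensity base 𝒜 U₁) (fun z => 𝒜 U₁ z - 𝒜 U z - (𝒬 U z - q₀)) z := by
  have hA : (((𝒜 U₁ z).re : ℝ) : ℂ) = 𝒜 U₁ z := by
    apply Complex.ext <;> simp [hre]
  have key : Complex.exp (-(𝒜 U z + 𝒬 U z)) =
      Complex.exp (-q₀) * (Complex.exp (-(𝒜 U₁ z)) * Complex.exp (𝒜 U₁ z - 𝒜 U z - (𝒬 U z - q₀))) := by
    rw [← Complex.exp_add, ← Complex.exp_add]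
    congr 1
    ring
  rw [weight_apply, expWeight_apply, baseDensity_apply, Complex.ofReal_mul, Complex.ofReal_exp, Complex.ofReal_neg, hA,
    Pi.add_apply, Pi.add_apply, key]
  ring

/-- **THE DRESSED WEIGHT-SLICE SUPPLIER.**  A real regular base and an exponent slice ABOUT THE REFERENCE `ref` for the action
exponent `𝒜` (oscillation `s`), plus a perturbation slice for `𝒬` (oscillation `s₁` about a constant `q₀`), on the same window /
chart / radius, give a PROJECTIVE weight slice for the dressed weight `base·e^{−(𝒜+𝒬)}` with oscillation `s + s₁`: reference
density `ρ₀ = base·e^{−Re 𝒜_{ref U₀}}` (UNDRESSED, real, of positive mass), `σ_t = 𝒜_{ref U₀} − 𝒜_{move U₀ d t} − (𝒬_{move U₀ d t} − q₀)`,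
constant `c = e^{−q₀}`, `Ω = Ω_𝒜 ∩ Ω_𝒬`.  No reality is asked of `𝒬`. [folklore] -/
theorem weightSliceProj_of_dressed (hB : RealBaseAt ref base 𝒜 μ 𝒦) (hE : ExponentSliceAt ref 𝒜 μ move N 𝒦 w ϱ s)
    (hP : PertSlice 𝒬 μ move N 𝒦 w ϱ s₁) : WeightSliceProj (expWeight base (𝒜 + 𝒬)) μ move N 𝒦 w ϱ (s + s₁) := by
  intro U₀ hU₀ d hd hdw
  obtain ⟨Ω, hΩ, hballs, hAm, hAd, hAb⟩ := hE U₀ hU₀ d hd hdw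
  obtain ⟨Ω₁, hΩ₁, hballs₁, hPm, hPd, q₀, hPb⟩ := hP U₀ hU₀ d hd hdw
  obtain ⟨hb, hpos, hB'⟩ := hB
  obtain ⟨hm0, hre, hint⟩ := hB' U₀ hU₀
  refine ⟨Ω ∩ Ω₁, hΩ.inter hΩ₁, fun x hx => subset_inter (hballs x hx) (hballs₁ x hx), baseDensity base 𝒜 (ref U₀),
    baseDensity_nonneg_ae hb 𝒜 (ref U₀), hint, integral_baseDensity_pos hb hint hpos,
    fun t z => 𝒜 (ref U₀) z - 𝒜 (move U₀ d t) z - (𝒬 (move U₀ d t) z - q₀),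
    fun t ht => (hm0.sub (hAm t ht.1)).sub ((hPm t ht.2).sub aestronglyMeasurable_const), ?_, ?_,
    Complex.exp (-q₀), Complex.exp_ne_zero _, ?_⟩
  · filter_upwards [hAd, hPd] with z hz hz₁
    exact ((differentiableOn_const _).sub (hz.mono inter_subset_left)).sub
      ((hz₁.mono inter_subset_right).sub (differentiableOn_const _))
  · filter_upwards [hAb, hPb] with z hz hz₁ t ht
    calc ‖𝒜 (ref U₀) z - 𝒜 (move U₀ d t) z - (𝒬 (move U₀ d t) z - q₀)‖
        ≤ ‖𝒜 (ref U₀) z - 𝒜 (move U₀ d t) z‖ + ‖𝒬 (move U₀ d t) z - q₀‖ := norm_sub_le _ _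
      _ ≤ s + s₁ := add_le_add (by rw [norm_sub_rev]; exact hz t ht.1) (hz₁ t ht.2)
  · intro t _
    filter_upwards [hre] with z hz
    exact expWeight_add_eq_mul_weight hz q₀

variable {F : Type*} [NormedAddCommGroup F] [NormedSpace ℂ F]

/-- The dressed step law: with `s + s₁ ≤ 1` and `D` of full measure, `wOp (base·e^{−(𝒜+𝒬)}) μ z₀` obeys an `OpSliceOn` on
`BddClass F μ` with constant `e^{3(s+s₁)}` ((1.75) by name, via `opSliceOn_wOp_proj`). [folklore] -/
theorem opSliceOn_wOp_dressed [CompleteSpace F] {D : Set Z} (z₀ : Z) (hB : RealBaseAt ref base 𝒜 μ 𝒦)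
    (hE : ExponentSliceAt ref 𝒜 μ move N 𝒦 w ϱ s) (hP : PertSlice 𝒬 μ move N 𝒦 w ϱ s₁) (hs : s + s₁ ≤ 1)
    (hD : ∀ᵐ z ∂μ, z ∈ D) :
    OpSliceOn (BddClass F μ) (wOp (expWeight base (𝒜 + 𝒬)) μ z₀) D move N 𝒦 w ϱ (Real.exp (3 * (s + s₁))) :=
  opSliceOn_wOp_proj z₀ (weightSliceProj_of_dressed hB hE hP) hs hD

end Dressed

/-! ## §4 The dressed lattice capstone: action-exponent data + perturbation slices ⟹ `TransportsFromVar` (by name) [folklore] -/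

section CapstoneDressed

variable {B : Booking} {T : Trajectory B}
variable {R : Type*} [NormedRing R] [NormedAlgebra ℂ R] [MeasurableSpace R] {d : ℕ}
  {F : Type*} [NormedAddCommGroup F] [NormedSpace ℂ F] [CompleteSpace F]

/-- **THE DRESSED PIPELINE ON `ℤ^d` FED BY ACTION-EXPONENT DATA ABOUT REFERENCES PLUS PERTURBATION SLICES** —
`T4TrajectoryDensity.transportsFromVar_of_exponentSlicesAt_lattice` (v1.2.1) VERBATIM except that, per met step `k`, the step weight
is `base k · e^{−(𝒜 k + 𝒬 k)}`: the real regular base `hB` and the exponent slice `hE` concern the ACTION exponent `𝒜 k` only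
(printed type), the observable-attached part `𝒬 k` is asked to be a perturbation slice of oscillation `s₁ k` (`hP`; NO reality, NO
reference, constants free), and the oscillation budget is `s k + s₁ k ≤ 1` (`hs`, `hdom`).  SAME conclusion
`T.TransportsFromVar (4c_δ/r) (fun i => ψ·α i) Gate`; at `𝒬 k = 0`, `s₁ = 0` the binders are v1.2.1's. [folklore] -/
theorem transportsFromVar_of_dressedExponent_lattice {Gate : ℕ → Prop} {Fn : B.Birth → ℕ → ℕ → Fld d R → F}
    {rel : B.Birth → ℕ → ℕ → Fld d R → Fld d R → Prop} {𝒦 : B.Birth → ℕ → ℕ → Set (Fld d R)}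
    {ref : ℕ → Fld d R → Fld d R} {base : ℕ → Fld d R → ℝ} {𝒜 𝒬 : ℕ → Fld d R → Fld d R → ℂ}
    {μ : ℕ → Measure (Fld d R)} {z₀ : ℕ → Fld d R} {D : ℕ → Set (Fld d R)}
    {defect : B.Birth → ℕ → ℕ → ℝ} {cδ ψ w r : ℝ} {s s₁ α θ : ℕ → ℝ} {ϱ : B.Birth → ℕ → ℕ → ℝ}
    (hα : ∀ i, 0 ≤ α i) (hr : 0 < r) (hw : 0 < w)
    (hsl : ∀ (b : B.Birth) (k' : ℕ), B.birthScale b ≤ k' → k' ≤ B.K → RanBelow Gate k' →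
      BirthSlice (Fn b k' k') latMove latN (𝒦 b k' k') w r (T.gen b k'))
    (hFn : ∀ (b : B.Birth) (k' k : ℕ), B.birthScale b ≤ k' → k' ≤ k → k + 1 ≤ B.K → RanBelow Gate (k + 1) →
      ∀ U, Fn b k' (k + 1) U = wOp (expWeight (base k) (𝒜 k + 𝒬 k)) (μ k) (z₀ k) U (fun z => Fn b k' k (U + z)))
    (h𝒢 : ∀ (b : B.Birth) (k' k : ℕ), B.birthScale b ≤ k' → k' ≤ k → k + 1 ≤ B.K → RanBelow Gate (k + 1) →
      ∀ U, (fun z => Fn b k' k (U + z)) ∈ BddClass F (μ k))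
    (hD : ∀ k, (D k).Nonempty) (hϱ : ∀ b k' k, 0 < ϱ b k' k)
    (hB : ∀ (b : B.Birth) (k' k : ℕ), B.birthScale b ≤ k' → k' ≤ k → k + 1 ≤ B.K → RanBelow Gate (k + 1) →
      RealBaseAt (ref k) (base k) (𝒜 k) (μ k) (𝒦 b k' (k + 1)))
    (hE : ∀ (b : B.Birth) (k' k : ℕ), B.birthScale b ≤ k' → k' ≤ k → k + 1 ≤ B.K → RanBelow Gate (k + 1) →
      ExponentSliceAt (ref k) (𝒜 k) (μ k) latMove latN (𝒦 b k' (k + 1)) w (ϱ b k' k) (s k))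
    (hP : ∀ (b : B.Birth) (k' k : ℕ), B.birthScale b ≤ k' → k' ≤ k → k + 1 ≤ B.K → RanBelow Gate (k + 1) →
      PertSlice (𝒬 k) (μ k) latMove latN (𝒦 b k' (k + 1)) w (ϱ b k' k) (s₁ k))
    (hs : ∀ k, s k + s₁ k ≤ 1) (hDμ : ∀ k, ∀ᵐ z ∂μ k, z ∈ D k)
    (hN1 : ∀ (b : B.Birth) (k' k : ℕ), B.birthScale b ≤ k' → k' ≤ k → k + 1 ≤ B.K →
      ∀ z ∈ D k, ∀ U ∈ 𝒦 b k' (k + 1), U + z ∈ 𝒦 b k' k)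
    (hN2 : ∀ (b : B.Birth) (k' k : ℕ), B.birthScale b ≤ k' → k' ≤ k → k + 1 ≤ B.K →
      ∀ U₀ ∈ 𝒦 b k' (k + 1), ∀ p : NDir d R, latN p ≤ w → ∀ z' ∈ D k, latMove U₀ p 1 + z' ∈ 𝒦 b k' k)
    (hdiam : ∀ k, ∀ z ∈ D k, ∀ z' ∈ D k, ∀ x ν, ‖z x ν - z' x ν‖ ≤ θ k)
    (hθ : ∀ k, 0 < θ k ∧ θ k ≤ w)
    (hdom : ∀ (b : B.Birth) (k' k : ℕ), B.birthScale b ≤ k' → k' ≤ k → k + 1 ≤ B.K →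
      Real.exp (3 * (s k + s₁ k)) * (1 + 4 * θ k / ϱ b k' k) ≤ α k)
    (hinv : ∀ b k' k, GaugeInvariant (rel b k' k) (Fn b k' k))
    (hdefw : ∀ b k' k, defect b k' k ≤ w)
    (hrate : ∀ (b : B.Birth) (k' k : ℕ), B.birthScale b ≤ k' → k' ≤ k → k ≤ B.K →
      defect b k' k ≤ cδ * ψ ^ (k - k'))
    (hlin : ∀ (b : B.Birth) (k' k : ℕ), B.birthScale b ≤ k' → k' ≤ k → k ≤ B.K → RanBelow Gate k → ∀ ε > 0,
      ∃ U₀ ∈ 𝒦 b k' k, ∃ U₁ : Fld d R, RelGauge (rel b k' k) latMove latN U₀ U₁ (defect b k' k) ∧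
        T.lin b k' k ≤ ‖Fn b k' k U₁ - Fn b k' k U₀‖ + ε) :
    T.TransportsFromVar (4 * cδ / r) (fun i => ψ * α i) Gate :=
  transportsFromVar_of_linearOpSlicesOn_lattice (𝒢 := fun k => BddClass F (μ k))
    (E := fun k => wOp (expWeight (base k) (𝒜 k + 𝒬 k)) (μ k) (z₀ k)) (a := fun k => Real.exp (3 * (s k + s₁ k)))
    (ϱ := ϱ) (ω := θ)
    hα hr hw hsl hFn h𝒢 hD hϱ (fun k c => const_mem_bddClass (μ k) c)
    (fun _ _ hg _ hg' => sub_mem_bddClass hg hg')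
    (fun k U _ hg _ hg' => wOp_sub (expWeight (base k) (𝒜 k + 𝒬 k)) (μ k) (z₀ k) U hg hg')
    (fun k U c => wOp_const (expWeight (base k) (𝒜 k + 𝒬 k)) (μ k) (z₀ k) U c)
    (fun b k' k hbk' hk'k hk hran =>
      opSliceOn_wOp_dressed (z₀ k) (hB b k' k hbk' hk'k hk hran) (hE b k' k hbk' hk'k hk hran)
        (hP b k' k hbk' hk'k hk hran) (hs k) (hDμ k))
    hN1 hN2 hdiam hθ hdom hinv hdefw hrate hlin

end CapstoneDressed

end

end Summit.QuantumFields.BalabanUV.T4Continuum.T4TrajectoryDensityDressed
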